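import Summits.NavierStokesRegularity.NavierStokesRegularity.Theorems.GaldiLiouvilleGateCylinderBudgetsDefs

/-!
# Galdi's Liouville problem ⟨0895⟩, line «all-axes cylinder budget», obligation O1c′ — PACK Z:
# the cylinder zones in the tree's vocabulary

Route `GaldiLiouvilleGate`, items ⟨0895⟩/⟨0896⟩; LINE allaxes/cylbudget, combined Defs v3.1
(817120c4c833a18a; tree Defs of record `…Theorems.GaldiLiouvilleGateCylinderBudgetsDefs`).
Carve (Z) of the arbiter's kit `allaxes-O1c-limit-sigs.lean` (sha16 935d1df3dddf7f1f; ns-in-ser-a g2),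
statements verbatim: the dictionary between the `s = x₀² + x₁²` zones in which the one-stroke core
inequality `core_axialEnergy_bound` (`…AllAxesBudgetCore`) is written and the `r = cylRadius x`
zones of the Defs (`axialEnergyIn`, `swirlTail`, `PressureCylinderDecay`):

* Z1–Z4 `setOf_cylRadius_le_eq`, `setOf_lt_cylRadius_eq`, `setOf_cylRadius_lt_eq`, `setOf_window_eq`
  (`r ≤ t ↔ s ≤ t²` etc., `r = √s ≥ 0`);
* Z5 `ofReal_swirl_sq_div_eq_swirlRateSq`: `Γ²/s² = (u_θ/r)²` in `ℝ≥0∞` (`Γ = x₀u₁ − x₁u₀ = r u_θ`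
  off the axis, both sides `0` on it);
* Z6 `setOf_sq_le_subset_cylRadius_lt`: `{s ≤ 4T²} ⊆ {r < 2T + 1}`;
* Z7 `measurableSet_sZone`: measurability of the `s`-zones and `z`-collars.

Pure bookkeeping (no PDE); consumed by the final assembly `cylinderBookkeepingSplit_holds` (ser-a).
[folklore] No summit / no ⟨0895⟩–⟨0896⟩ claim is proved here; NS regularity is not touched.
-/

noncomputable section

-- the problem directory repeats the summit name (D-0017); core's `dupNamespace` linter fires
set_option linter.dupNamespace false

open MeasureTheory Set Filter Topology
open scoped ENNReal

namespace Summit.NavierStokesRegularity.NavierStokesRegularity.Theorems.GaldiLiouville.AllAxesBudget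

open Literature.Analysis.FluidPDE

/-! ### Z1–Z4: `r`-zones versus `s`-zones -/

/-- `r ≤ t ↔ s ≤ t²` for `t ≥ 0` (`r = √s ≥ 0`). [folklore] -/
theorem cylRadius_le_iff_sq_le {t : ℝ} (ht : 0 ≤ t) (x : EuclideanSpace ℝ (Fin 3)) :
    cylRadius x ≤ t ↔ x 0 ^ 2 + x 1 ^ 2 ≤ t ^ 2 := by
  rw [← cylRadius_sq x]
  exact (pow_le_pow_iff_left₀ (cylRadius_nonneg x) ht two_ne_zero).symm

/-- `t < r ↔ t² < s` for `t ≥ 0`. [folklore] -/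
theorem lt_cylRadius_iff_sq_lt {t : ℝ} (ht : 0 ≤ t) (x : EuclideanSpace ℝ (Fin 3)) :
    t < cylRadius x ↔ t ^ 2 < x 0 ^ 2 + x 1 ^ 2 := by
  rw [← cylRadius_sq x]
  exact (pow_lt_pow_iff_left₀ ht (cylRadius_nonneg x) two_ne_zero).symm

/-- `r < R ↔ s < R²` for `R ≥ 0`. [folklore] -/
theorem cylRadius_lt_iff_sq_lt {R : ℝ} (hR : 0 ≤ R) (x : EuclideanSpace ℝ (Fin 3)) :
    cylRadius x < R ↔ x 0 ^ 2 + x 1 ^ 2 < R ^ 2 := by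
  rw [← cylRadius_sq x]
  exact (pow_lt_pow_iff_left₀ (cylRadius_nonneg x) hR two_ne_zero).symm

/-- Z1 · `{r ≤ t} = {s ≤ t²}` for `t ≥ 0`. [folklore] -/
theorem setOf_cylRadius_le_eq {t : ℝ} (ht : 0 ≤ t) :
    {x : EuclideanSpace ℝ (Fin 3) | cylRadius x ≤ t} = {x | x 0 ^ 2 + x 1 ^ 2 ≤ t ^ 2} := by
  ext x
  exact cylRadius_le_iff_sq_le ht x

/-- Z2 · `{t < r} = {t² < s}` for `t ≥ 0`. [folklore] -/
theorem setOf_lt_cylRadius_eq {t : ℝ} (ht : 0 ≤ t) :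
    {x : EuclideanSpace ℝ (Fin 3) | t < cylRadius x} = {x | t ^ 2 < x 0 ^ 2 + x 1 ^ 2} := by
  ext x
  exact lt_cylRadius_iff_sq_lt ht x

/-- Z3 · `{r < R} = {s < R²}` for `R ≥ 0`. [folklore] -/
theorem setOf_cylRadius_lt_eq {R : ℝ} (hR : 0 ≤ R) :
    {x : EuclideanSpace ℝ (Fin 3) | cylRadius x < R} = {x | x 0 ^ 2 + x 1 ^ 2 < R ^ 2} := by
  ext x
  exact cylRadius_lt_iff_sq_lt hR x

/-- Z4 · the open dyadic window `{R < r < 2R} = {R² < s < 4R²}` for `R ≥ 0`. [folklore] -/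
theorem setOf_window_eq {R : ℝ} (hR : 0 ≤ R) :
    {x : EuclideanSpace ℝ (Fin 3) | R < cylRadius x ∧ cylRadius x < 2 * R} =
      {x | R ^ 2 < x 0 ^ 2 + x 1 ^ 2 ∧ x 0 ^ 2 + x 1 ^ 2 < 4 * R ^ 2} := by
  ext x
  simp only [mem_setOf_eq]
  rw [lt_cylRadius_iff_sq_lt hR x, cylRadius_lt_iff_sq_lt (by positivity : (0 : ℝ) ≤ 2 * R) x,
    show (2 * R) ^ 2 = 4 * R ^ 2 by ring]

/-! ### Z5: the swirl density -/

/-- Z5 · `Γ²/s² = (u_θ/r)²` as extended reals (`Γ = x₀u₁ − x₁u₀ = r u_θ` off the axis; both sides `0`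
on it). [folklore] -/
theorem ofReal_swirl_sq_div_eq_swirlRateSq (U : EuclideanSpace ℝ (Fin 3) → EuclideanSpace ℝ (Fin 3))
    (x : EuclideanSpace ℝ (Fin 3)) :
    ENNReal.ofReal ((x 0 * U x 1 - x 1 * U x 0) ^ 2 / (x 0 ^ 2 + x 1 ^ 2) ^ 2) = swirlRateSq U x := by
  unfold swirlRateSq
  congr 1
  rw [show x 0 * U x 1 - x 1 * U x 0 = swirl U x from rfl, ← cylRadius_sq x]
  by_cases hx : cylRadius x = 0
  · rw [swirl_eq_zero_of_cylRadius_eq_zero U hx, hx]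
    simp
  · rw [swirl_eq_cylRadius_mul_swirlVelocity U hx]
    field_simp

/-! ### Z6–Z7: a bounding cylinder and measurability -/

/-- Z6 · the solid cylinder `{s ≤ 4T²}` sits inside `{r < 2T + 1}` (`T ≥ 0`). [folklore] -/
theorem setOf_sq_le_subset_cylRadius_lt {T : ℝ} (hT : 0 ≤ T) :
    {x : EuclideanSpace ℝ (Fin 3) | x 0 ^ 2 + x 1 ^ 2 ≤ 4 * T ^ 2} ⊆ {x | cylRadius x < 2 * T + 1} := by
  intro x hx
  simp only [mem_setOf_eq] at hx ⊢
  have h2 : cylRadius x ≤ 2 * T := by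
    rw [cylRadius_le_iff_sq_le (by positivity : (0 : ℝ) ≤ 2 * T) x]
    nlinarith [hx]
  linarith

/-- Z7 · measurability of the `s`-zones `{a < s ∧ s ≤ b}`, `{s ≤ b}`, `{a < s}` and of the `z`-collars.
[folklore] -/
theorem measurableSet_sZone (a b : ℝ) :
    MeasurableSet {x : EuclideanSpace ℝ (Fin 3) | a < x 0 ^ 2 + x 1 ^ 2 ∧ x 0 ^ 2 + x 1 ^ 2 ≤ b} ∧
    MeasurableSet {x : EuclideanSpace ℝ (Fin 3) | x 0 ^ 2 + x 1 ^ 2 ≤ b} ∧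
    MeasurableSet {x : EuclideanSpace ℝ (Fin 3) | a < x 0 ^ 2 + x 1 ^ 2} ∧
    MeasurableSet {x : EuclideanSpace ℝ (Fin 3) | a ≤ |x 2|} ∧
    MeasurableSet {x : EuclideanSpace ℝ (Fin 3) | |x 2| ≤ b} := by
  have hs : Measurable fun x : EuclideanSpace ℝ (Fin 3) => x 0 ^ 2 + x 1 ^ 2 := by fun_prop
  have hz : Measurable fun x : EuclideanSpace ℝ (Fin 3) => |x 2| := by fun_prop
  exact ⟨(measurableSet_lt measurable_const hs).inter (measurableSet_le hs measurable_const),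
    measurableSet_le hs measurable_const, measurableSet_lt measurable_const hs,
    measurableSet_le measurable_const hz, measurableSet_le hz measurable_const⟩

end Summit.NavierStokesRegularity.NavierStokesRegularity.Theorems.GaldiLiouville.AllAxesBudget

end
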